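import Mathlib
import HarnessLib
import HarnessLib.Audit
import Summits.HodgeConjecture.HodgeConjecture.Theses.LimitExtension
import Summits.HodgeConjecture.HodgeConjecture.Theses.FiniteTreeOfFlavours

/-!
# Line `birth` — BC3 skeleton for the crux `HypersurfaceHodge` (stmt-HodgeConjecture-1491)

Route `LimitExtension` (route-HodgeConjecture-LimitExtension), crux of rank 3
`HypersurfaceHodge := ∀ ⦃n d⦄ ⦃X⦄, IsSmoothHypersurface n d X → HodgeConjectureFor n X` — the Hodge conjecture
(Hodge model ∧ every rational `(k,k)`-class in `H²ᵏ(X(ℂ);ℂ)` algebraic) for EVERY smooth hypersurface of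
`ℙⁿ⁺¹_ℂ`, of every dimension `n` and degree `d`. The same statement, verbatim, is the TARGET (rank 0) of route
`FiniteTreeOfFlavours` (`crux_shared` below is `Iff.rfl`), and the decomposition registered here is exactly the one
both route headers announce (LimitExtension "TWO-LAYER PLAN": `HypersurfaceHodge ⇐ FiniteTreeOfFlavours'
MovableClassesAlgebraic → RigidQbarClassesAlgebraic (+RigidImpliesQbar)`; FiniteTreeOfFlavours support
`HypersurfaceHodgeFromCruxes`, stmt-HodgeConjecture-14377).

THE LINE = the MOVABLE / RIGID dichotomy of a rational `(k,k)`-class `c` on a smooth `(n,d)`-hypersurface `X`.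
`c` MOVES := `c` is the restriction of a rational `(k,k)`-class `Λ` on a smooth projective `(n+1)`-fold `𝒴 → C`
fibred over a smooth projective curve with `X ≅ 𝒴_t` a fibre and only finitely many fibres isomorphic to `X`
(for `n ≥ 3`: the Hodge locus of `c` through `[X]` in `U_{n,d}/PGL` is positive-dimensional). Three registered
stubs, each an EXISTING open, grounded and refuter-checked item of route FiniteTreeOfFlavours, cited BY NAME
(so a proof of a stub is literally a proof of that item):

* `stub_movableClassesAlgebraic : MovableClassesAlgebraic` (stmt-HodgeConjecture-1493, crux rank 3 there) — every
  class that moves is algebraic: the variational half (Cattani–Deligne–Kaplan algebraicity of Hodge loci,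
  Baldi–Klingler–Ullmo finiteness of maximal atypical families for level ≥ 3, IVHS / Noether–Lefschetz
  explanation of the finitely many nodes, variational HC on flag loci). Consequence of the crux (drop `Moves`).
* `stub_rigidImpliesQbar : RigidImpliesQbar` (stmt-HodgeConjecture-1494, rank 4) — a hypersurface carrying a
  class that does NOT move is isomorphic to `V(F)` with `F` of degree `d` and algebraic coefficients: the
  field-of-definition bridge (Klingler–Otwinowska–Urbanik Conj. 1.5 / Cor. 1.14: special POINTS are the open
  case; bi-algebraic / Ax–Schanuel tools). Implied by HC (spreading out), NOT a formal consequence of the crux.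
* `stub_rigidQbarClassesAlgebraic : RigidQbarClassesAlgebraic` (stmt-HodgeConjecture-1495, rank 5) — on a
  hypersurface with a `ℚ̄`-form every rigid class is algebraic: the arithmetic half (contains HC for all CM /
  Fermat hypersurfaces: Shioda, Deligne's absolute Hodge cycles, André). Consequence of the crux.
* `HypersurfaceHodge_of : MovableClassesAlgebraic → RigidImpliesQbar → RigidQbarClassesAlgebraic →
  LimitExtension.HypersurfaceHodge` — THE skeleton theorem, a REAL proof (no sorry): the Hodge-model conjunct of
  `HodgeConjectureFor n X` is the route's PROVED support item `HodgeModels` (`HodgeModels_holds`, Theorems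
  `curveNetMordellWeil_hodgeModels_proof` @ 614fa71ac06a) applied to `hX.1 : IsSmoothProjective n X`; the cycle
  conjunct is the tautological case split `Classical.em (Moves c)`: movable ⇒ stub 1; rigid ⇒ stub 2 gives the
  `ℚ̄`-form, then stub 3.
* `FiniteTreeOfFlavours_HypersurfaceHodge_of` — the same composition concluding the shared item under its OTHER route
  name `FiniteTreeOfFlavours.HypersurfaceHodge` (the item's first `wanted_by` decl, which `ledger skeleton check`
  resolves by default), so the audit is clean for either decl.

`sorry` occurs ONLY in the three `stub_*` theorems. Honest status: stubs 1 and 3 are each strictly WEAKER than the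
crux as typed (extra hypotheses `Moves c`, resp. `ℚ̄`-form ∧ `¬ Moves c`) yet each still contains open mathematics
(stub 1 ⊇ HC along positive-dimensional Hodge loci of sextic fourfolds; stub 3 ⊇ HC for Fermat hypersurfaces of
degree ≥ 21); stub 2 is of a different shape altogether (conclusion = a `ℚ̄`-model, no cycles).

BC3 PROBES (seat folder `bc/HypersurfaceHodge_probe{,2,3}.lean`, `maxHeartbeats 400000` each, farm 2026-08-17):
`stub_i → crux` and `stub_i → HodgeConjecture` by `first | exact? | simpa | aesop` — all 6 FAIL (rc 1, "unsolved
goals ⊢ HypersurfaceHodge" / "⊢ HodgeConjecture" after "aesop: failed to prove the goal after exhaustive search");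
with the definitions unfolded (`simp [defs]` / `unfold; tauto` / `unfold; aesop`, one tactic per example) — all 9
FAIL (unsolved goals ×4, "Tactic `tauto` failed" ×3, whnf heartbeat timeout ×2); dedup `crux := by exact?` FAILS
("could not close the goal"). Converse record: `HodgeConjecture → crux` holds (`fun h _ _ _ hX => h hX.1`, below);
`crux → stub 1` and `crux → stub 3` hold by one-line terms (they are weakenings); `crux → stub 2` and
`HodgeConjecture → stub 2` FAIL the battery (a `ℚ̄`-model is not a formal consequence of algebraicity).
Disproof used: none exists for this crux (`Cruxes/HypersurfaceHodge/` had no workfile before this one); negatives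
index (2 entries: Fermat–K3 multisets, E-line matrices) is untouched by all three stubs.
-/

-- `Summit.<Summit>.<Problem>`: for the single-conjunct summit the duplicate `HodgeConjecture.HodgeConjecture` is mandated.
set_option linter.dupNamespace false
set_option linter.unusedVariables false

namespace Summit.HodgeConjecture.HodgeConjecture.Cruxes.HypersurfaceHodge.Birth

-- Stub signatures and the hypotheses of `HypersurfaceHodge_of` are written FULLY QUALIFIED on purpose: the
-- registered signature text must be statable verbatim from any file importing the FiniteTreeOfFlavours route.
open Summit.HodgeConjecture.HodgeConjecture.Theses.LimitExtension (HodgeModels_holds)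

/-! ## Sanity: the crux is shared verbatim with FiniteTreeOfFlavours' target, and is a special case of the summit -/

/-- The two route decls named `HypersurfaceHodge` are the same proposition, syntactically. -/
example : Summit.HodgeConjecture.HodgeConjecture.Theses.LimitExtension.HypersurfaceHodge ↔
    Summit.HodgeConjecture.HodgeConjecture.Theses.FiniteTreeOfFlavours.HypersurfaceHodge :=
  Iff.rfl

/-- `S → C` (recorded converse probe): the crux is a CONSEQUENCE of the summit — HC for all smooth projective
varieties restricted to hypersurfaces (`IsSmoothHypersurface n d X` begins with `IsSmoothProjective n X`). It is
used TOWARD the summit through the route's `PullbackGlue` / `closes`. -/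
example (h : _root_.HodgeConjecture) :
    Summit.HodgeConjecture.HodgeConjecture.Theses.LimitExtension.HypersurfaceHodge :=
  fun _n _d _X hX => h hX.1

/-! ## The three registered stubs (existing items of route FiniteTreeOfFlavours, by name) -/

/-- **Stub 1 — movable classes are algebraic** (= item stmt-HodgeConjecture-1493,
`FiniteTreeOfFlavours.MovableClassesAlgebraic`, verbatim by name). For every smooth `(n,d)`-hypersurface `X` and
every rational `(k,k)`-class `c ∈ H²ᵏ(X(ℂ);ℂ)` that MOVES (restriction of a rational `(k,k)`-class on a smooth
projective `(n+1)`-fold over a smooth projective curve, `X` a fibre, finitely many fibres `≅ X`), `c` is algebraic.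
Why plausibly true: implied by HC; mechanism = algebraicity + finiteness of the maximal atypical Hodge-locus
families (CDK 1995; Baldi–Klingler–Ullmo 2024 Thm 2.6 / Cor 2.7 for `n ≥ 3, d ≥ 6`) + cycle-explanation of each
node (Otwinowska 2002, Voisin Hodge II ch. 5–6, variational HC on flag loci arXiv:1404.7519, arXiv:2104.14845).
Why it might fail: an unexplained positive-dimensional Hodge-locus component (an HC counterexample FAMILY); below
the first BKU layer the tree may be infinite. Size: open problem (XL). -/
theorem stub_movableClassesAlgebraic :
    Summit.HodgeConjecture.HodgeConjecture.Theses.FiniteTreeOfFlavours.MovableClassesAlgebraic := by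
  sorry

/-- **Stub 2 — rigid implies `ℚ̄`** (= item stmt-HodgeConjecture-1494, `FiniteTreeOfFlavours.RigidImpliesQbar`,
verbatim by name). If a smooth `(n,d)`-hypersurface carries a rational `(k,k)`-class that does NOT move, then
`X ≅ V(F)` for a homogeneous `F` of degree `d` with algebraic coefficients. Why plausibly true: implied by HC
(spread out `(X, cycle)` over a `ℚ̄`-variety; a transcendental modulus gives a non-isotrivial curve along which the
class stays algebraic, i.e. it moves); it is the residual 'special points are defined over `ℚ̄`' case of
Klingler–Otwinowska–Urbanik 2023 (Conj. 1.5, Cor. 1.13/1.14), cf. Saito–Schnell arXiv:1408.2488, Voisin 2007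
(absolute-Hodge criteria). Why it might fail: an isolated transcendental point of a Hodge locus (would also refute
HC). Size: open (L–XL); NOT a formal consequence of the crux. -/
theorem stub_rigidImpliesQbar :
    Summit.HodgeConjecture.HodgeConjecture.Theses.FiniteTreeOfFlavours.RigidImpliesQbar := by
  sorry

/-- **Stub 3 — rigid classes on `ℚ̄`-hypersurfaces are algebraic** (= item stmt-HodgeConjecture-1495,
`FiniteTreeOfFlavours.RigidQbarClassesAlgebraic`, verbatim by name). On a smooth `(n,d)`-hypersurface with a
`ℚ̄`-form, every rational `(k,k)`-class that does not move is algebraic. Why plausibly true: implied by HC; the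
arithmetic heart — contains HC for every CM hypersurface (Fermat `Xⁿₘ`: known for `m` prime or `m ≤ 20`, Shioda
1979; Deligne 1982 absolute Hodge cycles; André motivated cycles). Why it might fail: Fermat degree ≥ 21 in high
dimension (Shioda's criterion fails, Aoki classes, fake linear cycles arXiv:2112.14818); non-CM rigid classes carry
no structure. Size: open problem (XL). -/
theorem stub_rigidQbarClassesAlgebraic :
    Summit.HodgeConjecture.HodgeConjecture.Theses.FiniteTreeOfFlavours.RigidQbarClassesAlgebraic := by
  sorry

/-! ## The composition: the three stubs prove the crux BY NAME (sorry-free) -/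

/-- **THE SKELETON THEOREM** (BC3 shape `stub₁-sig → stub₂-sig → stub₃-sig → crux`, conclusion = the route decl
`Summit.HodgeConjecture.HodgeConjecture.Theses.LimitExtension.HypersurfaceHodge` BY NAME). Real proof: for a
smooth hypersurface `X` (`hX.1 : IsSmoothProjective n X`) the Hodge-model conjunct of `HodgeConjectureFor n X` is
the route's proved support `HodgeModels` (`HodgeModels_holds`); for the cycle conjunct split on whether the class
`c` moves (`Classical.em`): if it moves, stub 1; if not, stub 2 yields a `ℚ̄`-form of `X` and stub 3 applies.
[folklore] -/
theorem HypersurfaceHodge_of :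
    Summit.HodgeConjecture.HodgeConjecture.Theses.FiniteTreeOfFlavours.MovableClassesAlgebraic →
    Summit.HodgeConjecture.HodgeConjecture.Theses.FiniteTreeOfFlavours.RigidImpliesQbar →
    Summit.HodgeConjecture.HodgeConjecture.Theses.FiniteTreeOfFlavours.RigidQbarClassesAlgebraic →
      Summit.HodgeConjecture.HodgeConjecture.Theses.LimitExtension.HypersurfaceHodge := by
  intro hMov hQbar hRig n d X hX
  refine ⟨HodgeModels_holds hX.1, fun k c hc hkk => ?_⟩
  exact (Classical.em _).elim (fun hmov => hMov hX k c hc hkk hmov)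
    (fun hrig => hRig hX (hQbar hX k c hc hkk hrig) k c hc hkk hrig)

/-- **The same skeleton under the crux's other name.** The item stmt-HodgeConjecture-1491 is shared: its first
`wanted_by` decl — the one `ledger skeleton check` resolves by default — is the TARGET
`Summit.HodgeConjecture.HodgeConjecture.Theses.FiniteTreeOfFlavours.HypersurfaceHodge`, definitionally the same
proposition as the LimitExtension decl (`Iff.rfl` above). This theorem concludes that name BY NAME from the same
three stubs, so the skeleton audits clean whichever of the two route decls the checker is pointed at. [folklore] -/
theorem FiniteTreeOfFlavours_HypersurfaceHodge_of :
    Summit.HodgeConjecture.HodgeConjecture.Theses.FiniteTreeOfFlavours.MovableClassesAlgebraic →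
    Summit.HodgeConjecture.HodgeConjecture.Theses.FiniteTreeOfFlavours.RigidImpliesQbar →
    Summit.HodgeConjecture.HodgeConjecture.Theses.FiniteTreeOfFlavours.RigidQbarClassesAlgebraic →
      Summit.HodgeConjecture.HodgeConjecture.Theses.FiniteTreeOfFlavours.HypersurfaceHodge :=
  fun hMov hQbar hRig => HypersurfaceHodge_of hMov hQbar hRig

/-- The skeleton instantiated: the crux (under both names) from the three DECLARED stubs (its only `sorry`s,
transitively). -/
example : Summit.HodgeConjecture.HodgeConjecture.Theses.LimitExtension.HypersurfaceHodge :=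
  HypersurfaceHodge_of stub_movableClassesAlgebraic stub_rigidImpliesQbar stub_rigidQbarClassesAlgebraic

example : Summit.HodgeConjecture.HodgeConjecture.Theses.FiniteTreeOfFlavours.HypersurfaceHodge :=
  FiniteTreeOfFlavours_HypersurfaceHodge_of
    stub_movableClassesAlgebraic stub_rigidImpliesQbar stub_rigidQbarClassesAlgebraic

end Summit.HodgeConjecture.HodgeConjecture.Cruxes.HypersurfaceHodge.Birth
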